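import Literature.AlgebraicGeometry.Resolution.RelativeCurveConstantsCharZero
import Literature.AlgebraicGeometry.Resolution.GeneralizedStabilityHenselizedRational
import HarnessLib

/-!
# The valuative input (J1) of Thm. 3.3.1 in residue characteristic `0`, in the shape of the assembly

Topic: `Literature/AlgebraicGeometry/Resolution` (valued function fields). M. Temkin, *Inseparable
local uniformization*, J. Algebra 373 (2013) = arXiv:0804.1554v3, Thm. 3.3.1 (tree:
`Temkin2013RelativeCurveSmoothFibre`): the assembly `Temkin2013RelativeCurveSmoothFibre.of_inputs`
(`RelativeCurveSmoothFibreAssembly.lean`) consumes the valuative input in the shape (J1) stated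
there. This file PROVES (J1) when the residue characteristic is `0` (`ringExpChar Ω = 1`), from
`exists_finset_le_henselization_closure_of_charZero` (`RelativeCurveConstantsCharZero.lean`):
no purely inseparable constants (`S = ∅`), the separable constants `Y` algebraic over `k`
(separable, `k` being of characteristic `0`), and the generator `t ∈ K₁` inverted if necessary
to lie in `O_V`.

* `valuativeInput_of_ringExpChar_eq_one` — **(J1) in residue characteristic `0`** — PROVED.

No definitions, no named facts; [folklore] given the cited file.

## Sources

* M. Temkin, arXiv:0804.1554v3, §3.3 (Thm. 3.3.1, proof, Step 2) with §3.2. [Temkin2013]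
-/

noncomputable section

open IsLocalRing

namespace Literature.AlgebraicGeometry.Resolution

universe u

/-- **(J1) in residue characteristic `0`.** For subfields `k ≤ K₁` of an algebraically closed
valued field `(Ω, V)` of exponential characteristic `1` with `K₁|k` finitely generated,
transcendence degree one (a transcendental `t₀ ∈ K₁` over which `K₁` is algebraic),
`|K₁^×|/|k^×|` torsion and `K̃₁/k̃` algebraic, the finite-level valuative datum of
`Temkin2013RelativeCurveSmoothFibre.of_inputs` exists, with `S = ∅`. (Rank one, separable
generation and the hypothesis on the residue characteristic of `V` beyond `ringExpChar Ω = 1`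
are not needed.) [cite: Temkin2013, Thm. 3.3.1 (proof, Step 2)] [folklore] -/
theorem valuativeInput_of_ringExpChar_eq_one {Ω : Type u} [Field Ω] [IsAlgClosed Ω]
    (V : ValuationSubring Ω) (k K₁ : Subfield Ω) (hkK₁ : k ≤ K₁)
    (hchar : ringExpChar (ResidueField V) = ringExpChar Ω) (hq : ringExpChar Ω = 1)
    (hfg : FGOver k K₁)
    (h1 : ∃ t ∈ K₁, Transcendental k t ∧
      ∀ z ∈ K₁, IsAlgebraic (IntermediateField.adjoin k ({t} : Set Ω)) z)
    (hvt : IsValueTorsionOver V k K₁) (hra : IsResiduallyAlgebraicOver V k K₁) :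
    ∃ (S Y : Finset Ω) (t : Ω), (∀ s ∈ S, ∃ n : ℕ, s ^ (ringExpChar Ω) ^ n ∈ k) ∧
      (∀ y ∈ Y, IsSeparable (Subfield.closure ((k : Set Ω) ∪ ↑S)) y) ∧
      t ∈ K₁ ⊔ Subfield.closure ((k : Set Ω) ∪ ↑S) ∧ t ∈ V ∧ Transcendental k t ∧
      (↑Y : Set Ω) ⊆ henselization V (K₁ ⊔ Subfield.closure ((k : Set Ω) ∪ ↑S)) ∧
      K₁ ≤ henselization V (Subfield.closure ((k : Set Ω) ∪ ↑S ∪ ↑Y ∪ {t})) := by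
  classical
  -- residue characteristic `0`
  haveI : ExpChar (ResidueField V) 1 := ringExpChar.of_eq (hchar.trans hq)
  haveI : CharZero (ResidueField V) := charZero_of_expChar_one' (ResidueField V)
  haveI : ExpChar Ω 1 := ringExpChar.of_eq hq
  haveI : CharZero Ω := charZero_of_expChar_one' Ω
  obtain ⟨t₀, ht₀K₁, ht₀tr, halg⟩ := h1
  -- the constants: finitely many elements of `K₁^h` algebraic over `k`
  obtain ⟨s, hsK₁h, hsalg, hgen⟩ :=
    exists_finset_le_henselization_closure_of_charZero V hkK₁ hfg ht₀K₁ halg hvt hra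
  -- the generator in `O_V`: `t₀` or `t₀⁻¹`
  have ht₀0 : t₀ ≠ 0 := fun h0 => ht₀tr (h0 ▸ isAlgebraic_zero)
  obtain ⟨t, htK₁, htV, httr, hclos⟩ : ∃ t : Ω, t ∈ K₁ ∧ t ∈ V ∧ Transcendental k t ∧
      Subfield.closure ((k : Set Ω) ∪ ↑s ∪ {t₀}) ≤ Subfield.closure ((k : Set Ω) ∪ ↑s ∪ {t}) := by
    rcases V.mem_or_inv_mem t₀ with h | h
    · exact ⟨t₀, ht₀K₁, h, ht₀tr, le_rfl⟩
    · refine ⟨t₀⁻¹, inv_mem ht₀K₁, h, fun halg' => ht₀tr ?_, ?_⟩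
      · have := halg'.inv
        rwa [inv_inv] at this
      · refine Subfield.closure_le.mpr ?_
        rintro z (hz | hz)
        · exact Subfield.subset_closure (Or.inl hz)
        · rw [Set.mem_singleton_iff.mp hz]
          have h2 : t₀⁻¹ ∈ Subfield.closure ((k : Set Ω) ∪ ↑s ∪ {t₀⁻¹}) :=
            Subfield.subset_closure (Or.inr rfl)
          have := inv_mem h2
          rwa [inv_inv] at this
  -- separability over `k` (characteristic `0`)
  haveI : CharZero k := (algebraMap k Ω).charZero
  haveI : PerfectField k := PerfectField.ofCharZero
  refine ⟨∅, s, t, fun _ h => (Finset.notMem_empty _ h).elim, fun y hy => ?_, ?_, htV, httr, ?_, ?_⟩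
  · -- `y` algebraic over `k`, hence separable; over `closure (k ∪ ∅) = k`
    have hyint : IsIntegral k y := (hsalg y hy).isIntegral
    have hsep : IsSeparable k y :=
      PerfectField.separable_of_irreducible (minpoly.irreducible hyint)
    refine isSeparable_of_subfield_le (fun z hz => Subfield.subset_closure (Or.inl hz)) hsep
  · exact (le_sup_left : K₁ ≤ K₁ ⊔ _) htK₁
  · intro y hy
    exact henselization_mono V Kuhlmann2010HenselizationIsHenselian_holds.{u}
      (le_sup_left : K₁ ≤ K₁ ⊔ _) (hsK₁h hy)
  · refine hgen.trans (henselization_mono V Kuhlmann2010HenselizationIsHenselian_holds.{u}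
      (hclos.trans (Subfield.closure_mono ?_)))
    rintro z ((hz | hz) | hz)
    · exact Or.inl (Or.inl (Or.inl hz))
    · exact Or.inl (Or.inr hz)
    · exact Or.inr hz

end Literature.AlgebraicGeometry.Resolution

end
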